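import Summits.FinalStateConjecture.FinalStateConjecture.Theses.ZeroEnergyKerrOrBomb
import Literature.Geometry.Lorentzian.TrivialDataAdmissible

/-!
# Crux `FinalStateFromKerrOrBomb` (stmt-FinalStateConjecture-17839) — negative-side support:
# what a refutation must contain, under the re-typed summit T2 (cdisprove seat, cycle 1)

The frame crux of route `ZeroEnergyKerrOrBomb` (rev 9) reads
`FinalStateFromKerrOrBomb := KerrOrBombModT → FinalStateConjecture`, the summit being the T2
re-typing (p126844: TAME Christodoulou genericity `InitialDataSet.IsTameChristodoulouGeneric … 1`,
`RaysStayInClosure`, honest radii, `IsFutureOriented`).  This file records, kernel-checked and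
sorry-free, the shape of any refutation of the crux and of the summit it reduces to:

* `not_finalStateFromKerrOrBomb_iff` — `¬ FinalStateFromKerrOrBomb ↔ KerrOrBombModT ∧
  ¬ FinalStateConjecture`: a disproof of the frame is a PROOF of the route's target (smooth
  stationary vacuum rigidity of Killing-mode-stable holes of the collar telescope) together with a
  REFUTATION of the summit;
* `not_isTameChristodoulouGeneric_of_forall_not` — tame Christodoulou genericity of ANY property `P`
  in ANY class `𝓓` with a member fails as soon as `P` fails on all of `𝓓` (the witnessing tame family
  through a bad datum consists of members of `𝓓`, hence of bad data); stated abstractly in `P`, so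
  that it survives further re-typings of the summit property (the predecessor crux's landed
  `StationaryLimitReduction/Negative/KillShape.lean`, p72863, inlined the pre-T2 property and the
  topology-free genericity and no longer elaborates);
* `not_finalStateConjecture_of_forall_not` / `…_slice` — hence the summit is refuted by a UNIFORM
  failure of the T2 summit property on one slice carrying an admissible datum, e.g. the Minkowski
  slice `ℝ³` with the proved-admissible trivial data (`trivialData_mem_admissibleVacuumData`);
* `not_finalStateFromKerrOrBomb_of` — the only kill of the crux conceivable in the present tree (no
  individual maximal Cauchy development is constructible): the target plus such a uniform failure.

Neither input is available (the target is the open smooth-rigidity problem and is tight against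
junk presentations — `Cruxes/FinalStateFromKerrOrBomb/Disproof.lean` §6; the T2 summit property is
expected to HOLD for the trivial data, `N = 0` dispersal), which is why the crux resists: in every
plausible world it is equivalent to the summit itself.  No definition is introduced; the summit
property is written out verbatim from `Summits/FinalStateConjecture/FinalStateConjecture/Statement.lean`.
-/

noncomputable section

-- every `Summit.FinalStateConjecture.FinalStateConjecture.…` name repeats the summit = sub-problem
-- segment (D-0017 layout); the duplicate is deliberate.
set_option linter.dupNamespace false

open scoped Manifold ContDiff

namespace Summit.FinalStateConjecture.FinalStateConjecture.Theorems.FinalStateFromKerrOrBomb.Negative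

open Summit.FinalStateConjecture.FinalStateConjecture.Theses.ZeroEnergyKerrOrBomb
open Literature.Geometry.Lorentzian

/-- **Shape of a refutation of the frame.** `FinalStateFromKerrOrBomb` is the implication
`KerrOrBombModT → FinalStateConjecture`, so its negation is exactly: the route's target holds AND the
summit statement fails. -/
theorem not_finalStateFromKerrOrBomb_iff :
    ¬ FinalStateFromKerrOrBomb ↔ (KerrOrBombModT ∧ ¬ _root_.FinalStateConjecture) :=
  Classical.not_imp

/-- **Uniform failure kills tame genericity.** If the class `𝓓` has a member `D` and the property
`P` fails for every member of `𝓓`, then `P` is not tame-Christodoulou-generic in `𝓓` with any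
positive number `m` of parameters: the tame immersed family through the bad datum `D` promised by
genericity consists of members of `𝓓`, so its member at the parameter `e₀ ≠ 0` is bad, contradicting
the genericity clause. -/
theorem not_isTameChristodoulouGeneric_of_forall_not {X : Type} [TopologicalSpace X]
    [ChartedSpace E3 X] [IsManifold (𝓡 3) ∞ X] {𝓓 : Set (InitialDataSet (𝓡 3) X)}
    {P : InitialDataSet (𝓡 3) X → Prop} {D : InitialDataSet (𝓡 3) X} (hD : D ∈ 𝓓)
    (h : ∀ D' ∈ 𝓓, ¬ P D') {m : ℕ} (hm : m ≠ 0) :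
    ¬ InitialDataSet.IsTameChristodoulouGeneric 𝓓 P m := by
  intro hG
  obtain ⟨e, F, -, -, -, -, hF𝓓, hgood⟩ := hG D ⟨hD, h D hD⟩
  exact hgood (EuclideanSpace.single ⟨0, Nat.pos_of_ne_zero hm⟩ 1) (by simp)
    ⟨hF𝓓 _, h _ (hF𝓓 _)⟩

/-- **Uniform failure of the T2 summit property on one admissible slice refutes the summit.** If `X`
carries an admissible datum `D` and the summit property (an MGHD exists; every MGHD has complete `𝓘⁺`
and a sub-extremal Kerr final-state decomposition of its self-determined exterior with rays staying in
its closure, exhaustive charts and future-oriented chart times) fails for every admissible datum on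
`X`, then `FinalStateConjecture` is false. -/
theorem not_finalStateConjecture_of_forall_not {X : Type} [TopologicalSpace X] [ChartedSpace E3 X]
    [IsManifold (𝓡 3) ∞ X] [T2Space X] [SecondCountableTopology X] [ConnectedSpace X]
    {D : InitialDataSet (𝓡 3) X} (hD : D ∈ admissibleVacuumData X)
    (h : ∀ D' ∈ admissibleVacuumData X,
      ¬ ((∃ 𝒟 : VacuumCauchyDevelopment D', 𝒟.IsMaximal) ∧
        ∀ 𝒟 : VacuumCauchyDevelopment D', 𝒟.IsMaximal →
          Summit.FinalStateConjecture.HasCompleteNullInfinity 𝒟.toCauchyDevelopment ∧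
            ∃ (O : Set 𝒟.carrier) (d : FinalStateDecomposition 𝒟.toSpacetime O 2),
              (∀ i, Kerr.IsSubextremal (d.mass i) (d.spin i)) ∧
                O = Summit.FinalStateConjecture.exteriorOf 𝒟.toCauchyDevelopment d.charted ∧
                  Summit.FinalStateConjecture.RaysStayInClosure 𝒟.toCauchyDevelopment O ∧
                    Summit.FinalStateConjecture.HasExhaustiveCharts d ∧
                      Summit.FinalStateConjecture.IsFutureOriented d)) :
    ¬ _root_.FinalStateConjecture :=
  fun hF ↦ not_isTameChristodoulouGeneric_of_forall_not hD h one_ne_zero (hF X)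

/-- **The Minkowski slice suffices.** `ℝ³ = Minkowski.slice` carries the admissible trivial data
(`trivialData_mem_admissibleVacuumData`), so a uniform failure of the T2 summit property on
`admissibleVacuumData Minkowski.slice` refutes `FinalStateConjecture`. (Expected NOT to occur: for
the trivial data the property is `N = 0` dispersal of Minkowski space, with the identity chart on
`{x⁰ > τ₀}` and `O = {x⁰ ≥ 0}`.) -/
theorem not_finalStateConjecture_of_forall_not_slice
    (h : ∀ D' ∈ admissibleVacuumData Minkowski.slice,
      ¬ ((∃ 𝒟 : VacuumCauchyDevelopment D', 𝒟.IsMaximal) ∧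
        ∀ 𝒟 : VacuumCauchyDevelopment D', 𝒟.IsMaximal →
          Summit.FinalStateConjecture.HasCompleteNullInfinity 𝒟.toCauchyDevelopment ∧
            ∃ (O : Set 𝒟.carrier) (d : FinalStateDecomposition 𝒟.toSpacetime O 2),
              (∀ i, Kerr.IsSubextremal (d.mass i) (d.spin i)) ∧
                O = Summit.FinalStateConjecture.exteriorOf 𝒟.toCauchyDevelopment d.charted ∧
                  Summit.FinalStateConjecture.RaysStayInClosure 𝒟.toCauchyDevelopment O ∧
                    Summit.FinalStateConjecture.HasExhaustiveCharts d ∧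
                      Summit.FinalStateConjecture.IsFutureOriented d)) :
    ¬ _root_.FinalStateConjecture :=
  not_finalStateConjecture_of_forall_not trivialData_mem_admissibleVacuumData h

/-- **The only kill of the frame conceivable in this tree**: a proof of the target `KerrOrBombModT`
together with a uniform failure of the T2 summit property on the Minkowski slice.  Recorded so that
the lead sees what a refutation of `FinalStateFromKerrOrBomb` would have to contain; both inputs are
out of reach. -/
theorem not_finalStateFromKerrOrBomb_of (hX : KerrOrBombModT)
    (h : ∀ D' ∈ admissibleVacuumData Minkowski.slice,
      ¬ ((∃ 𝒟 : VacuumCauchyDevelopment D', 𝒟.IsMaximal) ∧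
        ∀ 𝒟 : VacuumCauchyDevelopment D', 𝒟.IsMaximal →
          Summit.FinalStateConjecture.HasCompleteNullInfinity 𝒟.toCauchyDevelopment ∧
            ∃ (O : Set 𝒟.carrier) (d : FinalStateDecomposition 𝒟.toSpacetime O 2),
              (∀ i, Kerr.IsSubextremal (d.mass i) (d.spin i)) ∧
                O = Summit.FinalStateConjecture.exteriorOf 𝒟.toCauchyDevelopment d.charted ∧
                  Summit.FinalStateConjecture.RaysStayInClosure 𝒟.toCauchyDevelopment O ∧
                    Summit.FinalStateConjecture.HasExhaustiveCharts d ∧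
                      Summit.FinalStateConjecture.IsFutureOriented d)) :
    ¬ FinalStateFromKerrOrBomb :=
  not_finalStateFromKerrOrBomb_iff.2 ⟨hX, not_finalStateConjecture_of_forall_not_slice h⟩

end Summit.FinalStateConjecture.FinalStateConjecture.Theorems.FinalStateFromKerrOrBomb.Negative

end
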